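import Literature.Analysis.FluidPDE.PeriodicLerayGalerkinBasis
import Literature.Analysis.FluidPDE.SolenoidalL2Duality
import HarnessLib

/-!
# [BT1] the Galerkin limit: Helmholtz reduction of the pairings and `L²_σ`-density of the
  Galerkin spaces

Analysis/FluidPDE proof file (theorems only; no definitions, no named facts) in the DAG below the
named fact `Literature.Analysis.FluidPDE.bradshawTsai2017_thm_2_4_mollified`
(`PeriodicLerayExistence.lean`; Bradshaw–Tsai, Ann. Henri Poincaré 18 (2017) = arXiv:1510.07504
[BT1], proof of Thm 2.4, "through a standard limiting process"; Temam, *Navier–Stokes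
equations*, Ch. III, §3). The compactness step of the limit `k → ∞` of the Galerkin
approximants `U_k` (values in `𝒱 ⊂ L²_σ`) needs the equicontinuity in time of the pairings
`(U_k(t), ζ)` with **arbitrary** test fields `ζ` (the tree's
`AubinLions.exists_subseq_strong_limit_of_equicontinuous`), while the Galerkin system controls
only the pairings with elements of the Galerkin spaces (`exists_pairing_modulus`,
`PeriodicLerayGalerkinPairings`). The bridge is the Helmholtz–Leray projection: for `U ∈ L²_σ`,
`(U, ζ) = (U, Pζ)` (`P` the accepted `lerayProjector`, an orthogonal projection fixing `L²_σ`),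
and `Pζ ∈ L²_σ` is an `L²`-limit of elements of the Galerkin spaces `V_m = span{σ₀,…,σ_m}` of
the `C¹`-dense family `σ` of `PeriodicLerayGalerkinBasis`. This file proves:

* `eLpNorm_two_le_of_bound_of_tsupport_subset` — `‖f‖_{L²} ≤ C |B̄(0,N)|^{1/2}` for `|f| ≤ C`
  supported in `B̄(0,N)`;
* `exists_galerkinSpace_approx` — **every `w ∈ L²_σ(ℝ³)` is `δ`-close in `L²` to an element of
  some Galerkin space `V_m`** (density of `𝒱` in `L²_σ`, tree
  `denseRange_divFreeTestToSolenoidalL2`, and the `C¹`-density of `σ` in `𝒱` with controlled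
  supports, tree `exists_countable_dense_testDivFree`);
* `integral_inner_eq_inner_lerayProjector` — for a divergence-free test field `U` and an `L²`
  field `ζ`, `∫⟪U, ζ⟫ = ⟪[U], P[ζ]⟫_{L²}`;
* `abs_integral_inner_sub_le` — **the reduction**: if `‖P[ζ] − [g]‖_{L²} ≤ δ` then
  `|∫⟪U, ζ⟫ − ∫⟪U, g⟫| ≤ (∫|U|²)^{1/2} δ` for every divergence-free test field `U`.

## Mathlib / tree search

Tree (all used): `solenoidalL2`, `lerayProjector`, `lerayProjector_apply_of_mem`
(`LerayProjector`); `divFreeTest`, `divFreeTestToL2`, `coeFn_divFreeTestToL2`,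
`divFreeTestToL2_mem`, `divFreeTestToSolenoidalL2`, `denseRange_divFreeTestToSolenoidalL2`,
`inner_divFreeTestToL2` (`SolenoidalL2Duality`); `testDivFreeSubmodule`, `galerkinSpace`,
`mem_galerkinSpace`, `exists_countable_dense_testDivFree` (`PeriodicLerayGalerkinBasis`).
Mathlib: `Submodule.inner_starProjection_left_eq_right`, `MeasureTheory.L2.inner_def`,
`eLpNorm_le_of_ae_bound`, `eLpNorm_restrict_eq_of_support_subset`, `Lp.norm_toLp`.

## References

* Z. Bradshaw, T.-P. Tsai, Ann. Henri Poincaré 18 (2017) = arXiv:1510.07504, proof of Thm 2.4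
  [BradshawTsai2017AHP].
* R. Temam, *Navier–Stokes equations* (1977/79), Ch. I Thm. 1.4 (Helmholtz decomposition),
  Ch. III §3 (the Galerkin limit) [Temam1979].
-/

noncomputable section

open MeasureTheory Set Function Filter Topology TopologicalSpace Metric Module
open scoped NNReal ENNReal InnerProductSpace RealInnerProductSpace

namespace Literature.Analysis.FluidPDE

namespace BradshawTsai2017

/-! ### `L²` norms of bounded compactly supported fields -/

/-- **`‖f‖_{L²} ≤ |B̄(0,N)|^{1/2} C`** for a field bounded by `C` and supported in `B̄(0, N)`.
[folklore] -/
theorem eLpNorm_two_le_of_bound_of_tsupport_subset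
    {f : EuclideanSpace ℝ (Fin 3) → EuclideanSpace ℝ (Fin 3)} {C : ℝ} (hC : ∀ y, ‖f y‖ ≤ C)
    {N : ℝ} (hN : tsupport f ⊆ closedBall (0 : EuclideanSpace ℝ (Fin 3)) N) :
    eLpNorm f 2 (volume : Measure (EuclideanSpace ℝ (Fin 3))) ≤
      volume (closedBall (0 : EuclideanSpace ℝ (Fin 3)) N) ^ (1 / 2 : ℝ) * ENNReal.ofReal C := by
  have hsupp : support f ⊆ closedBall (0 : EuclideanSpace ℝ (Fin 3)) N :=
    (subset_tsupport f).trans hN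
  rw [← eLpNorm_restrict_eq_of_support_subset hsupp]
  have h := eLpNorm_le_of_ae_bound (p := (2 : ℝ≥0∞)) (f := f)
    (μ := (volume : Measure (EuclideanSpace ℝ (Fin 3))).restrict (closedBall 0 N))
    (Eventually.of_forall fun y => hC y)
  rw [Measure.restrict_apply_univ] at h
  simpa only [ENNReal.toReal_ofNat, one_div] using h

/-! ### Density of the Galerkin spaces in `L²_σ` -/

/-- **Every element of `L²_σ(ℝ³)` is an `L²`-limit of elements of the Galerkin spaces.** Let
`σ : ℕ → 𝒱` be `C¹`-dense with controlled supports (the property of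
`exists_countable_dense_testDivFree`). Then for every `w ∈ L²_σ` and `δ > 0` there are `m` and
`g ∈ V_m = span{σ₀,…,σ_m}` (indeed some `g = σ_m`), a divergence-free test field, with
`‖w − [g]‖_{L²} ≤ δ`: `𝒱` is dense in `L²_σ` by definition, and a `δ'`-approximation in the sup
norm with a common support ball is a `δ' |B̄(0,N)|^{1/2}`-approximation in `L²`. [cite: Temam1979, Ch. III §3 (choice of a basis of 𝒱 "free and total in V")] -/
theorem exists_galerkinSpace_approx {σ : ℕ → EuclideanSpace ℝ (Fin 3) → EuclideanSpace ℝ (Fin 3)}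
    (hσ : ∀ n, σ n ∈ testDivFreeSubmodule)
    (hσd : ∀ (N : ℕ) (ζ : EuclideanSpace ℝ (Fin 3) → EuclideanSpace ℝ (Fin 3)),
      ζ ∈ testDivFreeSubmodule → tsupport ζ ⊆ closedBall (0 : EuclideanSpace ℝ (Fin 3)) N →
        ∀ δ : ℝ, 0 < δ → ∃ n, tsupport (σ n) ⊆ closedBall (0 : EuclideanSpace ℝ (Fin 3)) N ∧
          ∀ y, ‖ζ y - σ n y‖ ≤ δ ∧ ‖fderiv ℝ ζ y - fderiv ℝ (σ n) y‖ ≤ δ)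
    (w : solenoidalL2 (EuclideanSpace ℝ (Fin 3))) {δ : ℝ} (hδ : 0 < δ) :
    ∃ (m : ℕ) (g : EuclideanSpace ℝ (Fin 3) → EuclideanSpace ℝ (Fin 3))
      (hg : g ∈ testDivFreeSubmodule), g ∈ galerkinSpace σ m ∧
      ‖(w : Lp (EuclideanSpace ℝ (Fin 3)) 2 (volume : Measure (EuclideanSpace ℝ (Fin 3)))) -
        divFreeTestToL2 (EuclideanSpace ℝ (Fin 3)) ⟨g, hg⟩‖ ≤ δ := by
  -- a test field `φ ∈ 𝒱` with `‖w − [φ]‖ < δ/2`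
  have hd := denseRange_divFreeTestToSolenoidalL2 (E := EuclideanSpace ℝ (Fin 3))
  obtain ⟨φ, hφ⟩ := Metric.denseRange_iff.1 hd w (δ / 2) (half_pos hδ)
  -- its support ball
  obtain ⟨R₀, hR₀⟩ := φ.2.1.hasCompactSupport.isCompact.isBounded.subset_closedBall
    (0 : EuclideanSpace ℝ (Fin 3))
  obtain ⟨N, hN⟩ := exists_nat_ge R₀
  have hφN : tsupport (φ : EuclideanSpace ℝ (Fin 3) → EuclideanSpace ℝ (Fin 3)) ⊆
      closedBall (0 : EuclideanSpace ℝ (Fin 3)) N := hR₀.trans (closedBall_subset_closedBall hN)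
  -- the volume of the ball and the sup-norm tolerance
  set vB : ℝ≥0∞ := volume (closedBall (0 : EuclideanSpace ℝ (Fin 3)) (N : ℝ)) with hvB
  have hvBtop : vB ≠ ⊤ := measure_closedBall_lt_top.ne
  set A : ℝ := (vB ^ (1 / 2 : ℝ)).toReal with hA
  have hA0 : 0 ≤ A := ENNReal.toReal_nonneg
  set δ' : ℝ := δ / 2 / (A + 1) with hδ'
  have hδ'0 : 0 < δ' := by positivity
  obtain ⟨n, hnsupp, hclose⟩ := hσd N φ φ.2 hφN δ' hδ'0
  refine ⟨n, σ n, hσ n, mem_galerkinSpace le_rfl, ?_⟩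
  -- `‖[φ] − [σ n]‖ ≤ δ' A ≤ δ/2`
  have hσ' : σ n ∈ divFreeTest (EuclideanSpace ℝ (Fin 3)) := hσ n
  have hbound : ∀ y, ‖(φ : EuclideanSpace ℝ (Fin 3) → EuclideanSpace ℝ (Fin 3)) y - σ n y‖ ≤ δ' :=
    fun y => (hclose y).1
  have hsupp : tsupport (fun y => (φ : EuclideanSpace ℝ (Fin 3) → EuclideanSpace ℝ (Fin 3)) y - σ n y) ⊆
      closedBall (0 : EuclideanSpace ℝ (Fin 3)) N := by
    refine closure_minimal (fun y hy => ?_) isClosed_closedBall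
    by_contra h
    have h1 : (φ : EuclideanSpace ℝ (Fin 3) → EuclideanSpace ℝ (Fin 3)) y = 0 :=
      image_eq_zero_of_notMem_tsupport fun h' => h (hφN h')
    have h2 : σ n y = 0 := image_eq_zero_of_notMem_tsupport fun h' => h (hnsupp h')
    exact hy (by simp [h1, h2])
  have hL2 : ‖divFreeTestToL2 (EuclideanSpace ℝ (Fin 3)) φ -
      divFreeTestToL2 (EuclideanSpace ℝ (Fin 3)) ⟨σ n, hσ'⟩‖ ≤ δ / 2 := by
    have e : divFreeTestToL2 (EuclideanSpace ℝ (Fin 3)) φ -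
        divFreeTestToL2 (EuclideanSpace ℝ (Fin 3)) ⟨σ n, hσ'⟩ =
        divFreeTestToL2 (EuclideanSpace ℝ (Fin 3)) (φ - ⟨σ n, hσ'⟩) := by
      rw [map_sub]
    rw [e, norm_divFreeTestToL2]
    have hle := eLpNorm_two_le_of_bound_of_tsupport_subset hbound hsupp
    have hfin : vB ^ (1 / 2 : ℝ) * ENNReal.ofReal δ' ≠ ⊤ :=
      ENNReal.mul_ne_top (ENNReal.rpow_ne_top_of_nonneg (by norm_num) hvBtop) ENNReal.ofReal_ne_top
    have h1 : (eLpNorm (((φ - ⟨σ n, hσ'⟩ : divFreeTest (EuclideanSpace ℝ (Fin 3))) :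
        EuclideanSpace ℝ (Fin 3) → EuclideanSpace ℝ (Fin 3))) 2 volume).toReal ≤
        (vB ^ (1 / 2 : ℝ) * ENNReal.ofReal δ').toReal := ENNReal.toReal_mono hfin hle
    refine h1.trans ?_
    rw [ENNReal.toReal_mul, ENNReal.toReal_ofReal hδ'0.le, ← hA]
    calc A * δ' = A * (δ / 2 / (A + 1)) := rfl
      _ ≤ (A + 1) * (δ / 2 / (A + 1)) := by gcongr; linarith
      _ = δ / 2 := by field_simp
  -- assemble
  have hw : dist w (divFreeTestToSolenoidalL2 (EuclideanSpace ℝ (Fin 3)) φ) < δ / 2 := hφ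
  rw [Subtype.dist_eq, dist_eq_norm, coe_divFreeTestToSolenoidalL2] at hw
  calc ‖(w : Lp (EuclideanSpace ℝ (Fin 3)) 2 (volume : Measure (EuclideanSpace ℝ (Fin 3)))) -
        divFreeTestToL2 (EuclideanSpace ℝ (Fin 3)) ⟨σ n, hσ'⟩‖
      = ‖((w : Lp (EuclideanSpace ℝ (Fin 3)) 2 (volume : Measure (EuclideanSpace ℝ (Fin 3)))) -
          divFreeTestToL2 (EuclideanSpace ℝ (Fin 3)) φ) +
          (divFreeTestToL2 (EuclideanSpace ℝ (Fin 3)) φ -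
            divFreeTestToL2 (EuclideanSpace ℝ (Fin 3)) ⟨σ n, hσ'⟩)‖ := by rw [sub_add_sub_cancel]
    _ ≤ ‖(w : Lp (EuclideanSpace ℝ (Fin 3)) 2 (volume : Measure (EuclideanSpace ℝ (Fin 3)))) -
          divFreeTestToL2 (EuclideanSpace ℝ (Fin 3)) φ‖ +
          ‖divFreeTestToL2 (EuclideanSpace ℝ (Fin 3)) φ -
            divFreeTestToL2 (EuclideanSpace ℝ (Fin 3)) ⟨σ n, hσ'⟩‖ := norm_add_le _ _
    _ ≤ δ / 2 + δ / 2 := add_le_add hw.le hL2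
    _ = δ := by ring

/-! ### The Helmholtz reduction of the pairings -/

/-- **`∫⟪U, ζ⟫ = ⟪[U], P[ζ]⟫_{L²}`** for a divergence-free test field `U` and `ζ ∈ L²`: the class
`[U]` lies in `L²_σ`, which the orthogonal (Leray) projector `P` fixes, and `P` is self-adjoint
(Temam, Ch. I, Thm. 1.4 / Rem. 1.6: `ζ = Pζ + ∇q`, `(U, ∇q) = 0`). [cite: Temam1979, Ch. I Thm. 1.4 and Rem. 1.6] -/
theorem integral_inner_eq_inner_lerayProjector
    {U : EuclideanSpace ℝ (Fin 3) → EuclideanSpace ℝ (Fin 3)} (hU : U ∈ testDivFreeSubmodule)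
    (ζ : Lp (EuclideanSpace ℝ (Fin 3)) 2 (volume : Measure (EuclideanSpace ℝ (Fin 3)))) :
    ∫ y, ⟪U y, (ζ : EuclideanSpace ℝ (Fin 3) → EuclideanSpace ℝ (Fin 3)) y⟫ =
      ⟪divFreeTestToL2 (EuclideanSpace ℝ (Fin 3)) ⟨U, hU⟩,
        lerayProjector (EuclideanSpace ℝ (Fin 3)) ζ⟫ := by
  have hmem : divFreeTestToL2 (EuclideanSpace ℝ (Fin 3)) ⟨U, hU⟩ ∈
      solenoidalL2 (EuclideanSpace ℝ (Fin 3)) := divFreeTestToL2_mem _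
  have h1 : ⟪divFreeTestToL2 (EuclideanSpace ℝ (Fin 3)) ⟨U, hU⟩,
      lerayProjector (EuclideanSpace ℝ (Fin 3)) ζ⟫ =
      ⟪divFreeTestToL2 (EuclideanSpace ℝ (Fin 3)) ⟨U, hU⟩, ζ⟫ := by
    rw [lerayProjector, ← Submodule.inner_starProjection_left_eq_right,
      ← lerayProjector, lerayProjector_apply_of_mem hmem]
  rw [h1, ← inner_conj_symm, inner_divFreeTestToL2]
  simp only [RCLike.conj_to_real]
  exact integral_congr_ae (Eventually.of_forall fun y => real_inner_comm _ _)

/-- The pairing of a divergence-free test field with an element of `𝒱` as an `L²` inner product.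
[folklore] -/
theorem integral_inner_eq_inner_divFreeTestToL2
    {U g : EuclideanSpace ℝ (Fin 3) → EuclideanSpace ℝ (Fin 3)} (hU : U ∈ testDivFreeSubmodule)
    (hg : g ∈ testDivFreeSubmodule) :
    ∫ y, ⟪U y, g y⟫ = ⟪divFreeTestToL2 (EuclideanSpace ℝ (Fin 3)) ⟨U, hU⟩,
      divFreeTestToL2 (EuclideanSpace ℝ (Fin 3)) ⟨g, hg⟩⟫ := by
  rw [inner_divFreeTestToL2]
  refine integral_congr_ae ?_
  filter_upwards [coeFn_divFreeTestToL2 (E := EuclideanSpace ℝ (Fin 3)) ⟨U, hU⟩] with y hy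
  rw [hy]

/-- The `L²` norm of the class of a test field: `‖[U]‖² = ∫|U|²`. [folklore] -/
theorem norm_divFreeTestToL2_sq {U : EuclideanSpace ℝ (Fin 3) → EuclideanSpace ℝ (Fin 3)}
    (hU : U ∈ testDivFreeSubmodule) :
    ‖divFreeTestToL2 (EuclideanSpace ℝ (Fin 3)) ⟨U, hU⟩‖ ^ 2 = ∫ y, ‖U y‖ ^ 2 := by
  rw [← real_inner_self_eq_norm_sq, ← integral_inner_eq_inner_divFreeTestToL2 hU hU]
  exact integral_congr_ae (Eventually.of_forall fun y => real_inner_self_eq_norm_sq _)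

/-- **The Helmholtz reduction of the pairings.** Let `ζ ∈ L²(ℝ³; ℝ³)` (e.g. the class of a test
field which need not be divergence free) and let `g ∈ 𝒱` approximate its Leray projection,
`‖P[ζ] − [g]‖_{L²} ≤ δ`. Then for every divergence-free test field `U` with `∫|U|² ≤ C_b`,
`|∫⟪U, ζ⟫ − ∫⟪U, g⟫| ≤ √C_b δ` — uniformly in `U`: the pairings of the (divergence-free)
Galerkin approximants with an arbitrary test field are controlled by their pairings with one
element of a Galerkin space. [cite: Temam1979, Ch. I Thm. 1.4 and Ch. III §3] -/
theorem abs_integral_inner_sub_le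
    {U : EuclideanSpace ℝ (Fin 3) → EuclideanSpace ℝ (Fin 3)} (hU : U ∈ testDivFreeSubmodule)
    {Cb : ℝ} (hCb : ∫ y, ‖U y‖ ^ 2 ≤ Cb)
    (ζ : Lp (EuclideanSpace ℝ (Fin 3)) 2 (volume : Measure (EuclideanSpace ℝ (Fin 3))))
    {g : EuclideanSpace ℝ (Fin 3) → EuclideanSpace ℝ (Fin 3)} (hg : g ∈ testDivFreeSubmodule)
    {δ : ℝ} (hδ : ‖lerayProjector (EuclideanSpace ℝ (Fin 3)) ζ -
      divFreeTestToL2 (EuclideanSpace ℝ (Fin 3)) ⟨g, hg⟩‖ ≤ δ) :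
    |(∫ y, ⟪U y, (ζ : EuclideanSpace ℝ (Fin 3) → EuclideanSpace ℝ (Fin 3)) y⟫) - ∫ y, ⟪U y, g y⟫| ≤
      Real.sqrt Cb * δ := by
  rw [integral_inner_eq_inner_lerayProjector hU ζ, integral_inner_eq_inner_divFreeTestToL2 hU hg,
    ← inner_sub_right]
  have hnorm : ‖divFreeTestToL2 (EuclideanSpace ℝ (Fin 3)) ⟨U, hU⟩‖ ≤ Real.sqrt Cb := by
    rw [← Real.sqrt_sq (norm_nonneg _), norm_divFreeTestToL2_sq hU]
    exact Real.sqrt_le_sqrt hCb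
  have hδ0 : 0 ≤ δ := (norm_nonneg _).trans hδ
  calc |⟪divFreeTestToL2 (EuclideanSpace ℝ (Fin 3)) ⟨U, hU⟩,
          lerayProjector (EuclideanSpace ℝ (Fin 3)) ζ -
            divFreeTestToL2 (EuclideanSpace ℝ (Fin 3)) ⟨g, hg⟩⟫|
      ≤ ‖divFreeTestToL2 (EuclideanSpace ℝ (Fin 3)) ⟨U, hU⟩‖ *
          ‖lerayProjector (EuclideanSpace ℝ (Fin 3)) ζ -
            divFreeTestToL2 (EuclideanSpace ℝ (Fin 3)) ⟨g, hg⟩‖ := abs_real_inner_le_norm _ _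
    _ ≤ Real.sqrt Cb * δ := mul_le_mul hnorm hδ (norm_nonneg _) (Real.sqrt_nonneg _)

end BradshawTsai2017

end Literature.Analysis.FluidPDE

end
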